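import Mathlib
import Summits.RiemannHypothesis.RiemannHypothesis.Theorems.IntegerScrewPropKKPackaged
import HarnessLib

/-!
# Route `IntegerScrew` — PROPOSITION K″ for the near-extreme cells `(p⁻, R, p)`, `R < p²`, packaged
# (CONTINUUM-LIMIT §27.2 (iii), §27.3)

The true near-extreme cells of THEOREM P₀ are the windows `W = {R/p < x ≤ R : x p-free}` of the atoms
`𝒜 = 𝒜(p⁻, R) = {x ≤ R : every prime of x < p}` (`Nat.smoothNumbers p`) with `p ≤ R < p²` (bottom `B = [1, Q]`,
`Q = ⌊R/p⌋ < p`, automatically p-free).  PROP. K″ inside the atom (`IntegerScrewPropKK.propKK_smooth` with `N = p`,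
hubs `P ∈ (Q, p − 1]` — p-free, and `bP ≤ Q(p−1) ≤ R`) with the hub mass `M ≥ log p/π_Q − 1`
(`IntegerScrewHubMass.hubMass_ge_log` at `Y = p − 1`) and every harmonic
sum sized as in `IntegerScrewPropKKPackaged` gives, in the regime `2e⁵·log Q + 2 ≤ log R − log Q` (`λ = log p`
large against `ℓ = log Q`, i.e. `u = log R/log p` close to `1`):

* **`propKK_thin_bottom_atom`** — for `2 ≤ Q = ⌊R/p⌋`, `R < p²` (so `p ≥ 3`), `2e⁵ log Q + 2 ≤ log R − log Q`, all `g`: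
  `(Σ_W g x/x − (S_W/H_Q)·Σ_{b≤Q} g b/b)² ≤ 2000·e²⁰·(log R + log 4 + e⁵ log(R+1)(log log R + 4))·D_𝒜(g)`
  (`W`, `𝒜` with `Nat.smoothNumbers p`, the atom `𝒜(p⁻, R)` of `IntegerScrewTheoremB.theoremB`).

In κ-units: κ(p⁻, R, p) = O((log(R/p) + 1)·log log R) for log p ≥ (2e⁵+1) log(R/p) + 2 — PROP. K″ (iii); the
complementary range is THEOREM B (`IntegerScrewTheoremB.theoremB`, κ = O(log R/log(R/p))).  RH-free, elementary.
Nothing in this file bears on the truth of RH.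
References: CONTINUUM-LIMIT §27 (rh-explicit A6-PIVOT); M. Suzuki, J. Lond. Math. Soc. (2) 108 (2023) 1448–1487
[Suzuki2023] for the screw matrices this serves.
-/

noncomputable section

set_option linter.dupNamespace false -- D-0017: `Summit.<S>.<S>.…` is the designed namespace

namespace Summit.RiemannHypothesis.RiemannHypothesis.Theorems.IntegerScrew

open Finset Real
open ArithmeticFunction (vonMangoldt)

/-- `0 ≤ c ≤ 8e⁵` gives `c² ≤ 64e¹⁰`. -/
theorem sq_le_of_le_eight_exp_five {c : ℝ} (hc0 : 0 ≤ c) (hc : c ≤ 8 * Real.exp 5) : c ^ 2 ≤ 64 * Real.exp 10 := by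
  have e10 : Real.exp 10 = Real.exp 5 * Real.exp 5 := by rw [← Real.exp_add]; norm_num
  have := pow_le_pow_left₀ hc0 hc 2
  rw [e10]; nlinarith

/-- **PROP. K″ for the near-extreme cell `(p⁻, R, p)` (CONTINUUM-LIMIT §27.2 (iii)), packaged.** -/
theorem propKK_thin_bottom_atom {p R : ℕ} (hQ : 2 ≤ R / p) (hRp : R < p * p)
    (hQR : 2 * Real.exp 5 * Real.log ((R / p : ℕ) : ℝ) + 2 ≤ Real.log R - Real.log ((R / p : ℕ) : ℝ))
    (g : ℕ → ℝ) :
    (∑ x ∈ (Ioc (R / p) R).filter (· ∈ Nat.smoothNumbers p), g x / x -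
        (∑ x ∈ (Ioc (R / p) R).filter (· ∈ Nat.smoothNumbers p), 1 / (x : ℝ)) /
            (∑ b ∈ Icc 1 (R / p), 1 / (b : ℝ)) * ∑ b ∈ Icc 1 (R / p), g b / b) ^ 2 ≤
      2000 * Real.exp 20 *
          (Real.log R + Real.log 4 + Real.exp 5 * Real.log ((R : ℝ) + 1) * (Real.log (Real.log R) + 4)) *
        ∑ x ∈ (Icc 1 R).filter (· ∈ Nat.smoothNumbers p),
          (1 / (x : ℝ)) * ∑ n ∈ x.divisors, (vonMangoldt n : ℝ) * (g x - g (x / n)) ^ 2 := by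
  set Q := R / p with hQdef
  have hppos : 0 < p := by
    by_contra h0
    have : p = 0 := by omega
    simp [this] at hQdef; omega
  have hp2 : 2 ≤ p := by
    by_contra h1
    have : p = 1 := by omega
    subst this
    simp at hRp hQdef; omega
  have he5 := Literature.NumberTheory.LFunctions.SiegelZero.HarmFlat.hundred_le_exp_five
  -- integer facts (hubs up to Y = p − 1)
  have hQp : Q < p := (Nat.div_lt_iff_lt_mul hppos).2 hRp
  have hQY : Q ≤ p - 1 := by omega
  have hQpR : Q * p ≤ R := Nat.div_mul_le_self R p
  have hQYR : Q * (p - 1) ≤ R := le_trans (Nat.mul_le_mul_left Q (Nat.sub_le p 1)) hQpR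
  have hpR : p ≤ R := by
    have : 2 * p ≤ Q * p := Nat.mul_le_mul_right p hQ
    omega
  have hp3 : 3 ≤ p := by
    by_contra h
    have hp2' : p = 2 := by omega
    subst hp2'
    omega
  have hY2 : 2 ≤ p - 1 := by omega
  have hYR : p - 1 ≤ R := le_trans (Nat.sub_le p 1) hpR
  have hR2 : 2 ≤ R := le_trans hp2 hpR
  have hQpos : 0 < Q := by omega
  have hYcast : (((p - 1 : ℕ) : ℝ)) + 1 = (p : ℝ) := by
    rw [Nat.cast_sub (by omega)]; push_cast; ring
  -- logarithms
  have hQ2 : (2 : ℝ) ≤ (Q : ℝ) := by exact_mod_cast hQ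
  have hℓ0 : (1 : ℝ) / 2 < Real.log Q := by
    have := Real.log_le_log (by norm_num) hQ2; linarith [Real.log_two_gt_d9]
  have hLℓ : 100 * Real.log Q ≤ Real.log R - Real.log Q := by nlinarith
  -- log p ≥ log R − log(Q+1) ≥ log R − log Q − log 2
  have hlogp : Real.log R - Real.log Q - Real.log 2 ≤ Real.log (p : ℝ) := by
    have hlt : (R : ℝ) < p * ((Q : ℝ) + 1) := by exact_mod_cast Nat.lt_mul_div_succ R hppos
    have hQ1 : (Q : ℝ) + 1 ≤ 2 * Q := by linarith
    have h1 : (R : ℝ) ≤ (p : ℝ) * (2 * Q) := by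
      have : (0 : ℝ) ≤ Q := by positivity
      have : (0 : ℝ) < p := by positivity
      nlinarith
    have h2 := Real.log_le_log (by positivity) h1
    rw [Real.log_mul (by positivity) (by positivity), Real.log_mul (by norm_num) (by positivity)] at h2
    linarith
  -- π_Q ≤ e⁵ log Q, hub mass
  set Pr := ∏ q ∈ (Q + 1).primesBelow, (1 - (1 : ℝ) / q)⁻¹ with hPr
  have hPrle : Pr ≤ Real.exp 5 * Real.log Q := prod_primesBelow_succ_inv_le hQ
  have hPr1 : 1 ≤ Pr := by
    rw [hPr, ← Finset.prod_const_one (s := (Q + 1).primesBelow)]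
    refine Finset.prod_le_prod (fun _ _ => zero_le_one) fun q hq => ?_
    have hq2 : (2 : ℝ) ≤ q := by exact_mod_cast (Nat.mem_primesBelow.1 hq).2.two_le
    have h1 : 0 < 1 - (1 : ℝ) / q := by
      have : (1 : ℝ) / q ≤ 1 / 2 := by rw [div_le_div_iff₀ (by linarith) (by norm_num)]; linarith
      linarith
    have h2 : 1 - (1 : ℝ) / q ≤ 1 := by
      have : 0 ≤ (1 : ℝ) / q := by positivity
      linarith
    simpa using (one_le_inv₀ h1).2 h2
  have hPr0 : 0 < Pr := by linarith
  have hgap : (Real.log R - Real.log Q) / 2 ≤ Real.log (p : ℝ) - Pr := by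
    nlinarith [Real.log_two_lt_d9]
  set M := ∑ P ∈ (Ioc Q (p - 1)).filter (fun r => ∀ q ∈ r.primeFactors, Q + 1 ≤ q), 1 / (P : ℝ) with hM
  have hMge : Real.log (p : ℝ) / Pr - 1 ≤ M := by
    have := hubMass_ge_log (Q := Q) (Y := p - 1) hQY
    rwa [hYcast] at this
  have hgap0 : 0 < Real.log (p : ℝ) - Pr := by nlinarith
  have hMpos : 0 < M := by
    have : 0 < Real.log (p : ℝ) / Pr - 1 := by
      rw [sub_pos, lt_div_iff₀ hPr0]; linarith
    linarith
  -- K″ inside the atom 𝒜(p⁻, R): N = p, Y = p − 1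
  have h := propKK_smooth (N := p) (Y := p - 1) (by omega : 1 ≤ Q) hY2 hQYR hQp (by omega) hMpos g
  -- harmonic sums
  set SW := ∑ x ∈ (Ioc Q R).filter (· ∈ Nat.smoothNumbers p), 1 / (x : ℝ) with hSW
  set HQ := ∑ b ∈ Icc 1 Q, 1 / (b : ℝ) with hHQ
  have hSW0 : 0 ≤ SW := Finset.sum_nonneg fun x _ => by positivity
  have hSWle : SW ≤ 1 + Real.log R := by
    refine le_trans (Finset.sum_le_sum_of_subset_of_nonneg (fun x hx => ?_) fun x _ _ => by positivity)
      (harmonic_Icc_le_one_add_log (R := R) (by omega))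
    have := Finset.mem_Ioc.1 (Finset.mem_filter.1 hx).1; exact Finset.mem_Icc.2 ⟨by omega, this.2⟩
  have hHQge' : Real.log ((Q : ℝ) + 1) ≤ HQ := log_succ_le_harmonic_Icc Q
  have hℓl1 : Real.log Q ≤ Real.log ((Q : ℝ) + 1) := Real.log_le_log (by positivity) (by linarith)
  have hHQge : Real.log Q ≤ HQ := hℓl1.trans hHQge'
  have hHQle : HQ ≤ 1 + Real.log Q := harmonic_Icc_le_one_add_log (R := Q) (by omega)
  have hHQpos : 0 < HQ := by linarith
  have hℓ'1 : 1 ≤ Real.log ((Q : ℝ) + 1) := by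
    have h3 : (3 : ℝ) ≤ (Q : ℝ) + 1 := by linarith
    have h3' : (1 : ℝ) ≤ Real.log 3 := by
      rw [← Real.log_exp 1]
      exact Real.log_le_log (Real.exp_pos 1) (by have := Real.exp_one_lt_d9; linarith)
    linarith [Real.log_le_log (by norm_num) h3]
  -- (i) coefficient: SW/(HQ·M) ≤ SW·Pr/(HQ·(log(p+1) − Pr)) ≤ 8e⁵
  have hcoef1 : SW / (HQ * M) ≤ SW * Pr / (HQ * (Real.log (p : ℝ) - Pr)) := by
    rw [div_le_div_iff₀ (mul_pos hHQpos hMpos) (mul_pos hHQpos hgap0)]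
    have hPM : Real.log (p : ℝ) - Pr ≤ Pr * M := by
      have := mul_le_mul_of_nonneg_left hMge hPr0.le
      have e : Pr * (Real.log (p : ℝ) / Pr - 1) = Real.log (p : ℝ) - Pr := by field_simp
      linarith
    have h1 := mul_le_mul_of_nonneg_left hPM (mul_nonneg hSW0 hHQpos.le)
    have e1 : SW * (HQ * (Real.log (p : ℝ) - Pr)) = SW * HQ * (Real.log (p : ℝ) - Pr) := by ring
    have e2 : SW * Pr * (HQ * M) = SW * HQ * (Pr * M) := by ring
    rw [e1, e2]; exact h1
  have hden : 0 < HQ * (Real.log (p : ℝ) - Pr) := mul_pos hHQpos hgap0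
  have hcoef2 : SW * Pr / (HQ * (Real.log (p : ℝ) - Pr)) ≤ 8 * Real.exp 5 := by
    rw [div_le_iff₀ hden]
    exact thin_bottom_coef_le hSWle hHQge hPr1 hPrle hgap hLℓ hℓ0
  have hc0 : 0 ≤ SW / (HQ * M) := div_nonneg hSW0 (mul_pos hHQpos hMpos).le
  have hc2 : (SW / (HQ * M)) ^ 2 ≤ 64 * Real.exp 10 := sq_le_of_le_eight_exp_five hc0 (hcoef1.trans hcoef2)
  -- (ii) H_Q·E_α(Q,p) ≤ 9·E_K(R)
  set G := Real.log R + Real.log 4 + Real.exp 5 * Real.log ((R : ℝ) + 1) * (Real.log (Real.log R) + 4) with hG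
  set GY := Real.log ((p - 1 : ℕ) : ℝ) + Real.log 4 +
    Real.exp 5 * Real.log (((p - 1 : ℕ) : ℝ) + 1) * (Real.log (Real.log ((p - 1 : ℕ) : ℝ)) + 4) with hGY
  have hEK0 : 0 ≤ Real.exp 10 * G := EK_nonneg hR2
  have hGYle : GY ≤ G := energyProfile_mono hY2 hYR
  have hGY0 : 0 ≤ GY := (mul_nonneg_iff_of_pos_left (Real.exp_pos 10)).1 (EK_nonneg hY2)
  have hA : HQ * (4 * (1 + Real.exp 5) ^ 2 / Real.log ((Q : ℝ) + 1) ^ 2 * GY) ≤ 9 * (Real.exp 10 * G) :=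
    thin_bottom_Ealpha_le hℓ'1 (by linarith) hGYle hGY0
  -- (iii) assemble
  have hD0 : 0 ≤ ∑ x ∈ (Icc 1 R).filter (· ∈ Nat.smoothNumbers p),
      (1 / (x : ℝ)) * ∑ n ∈ x.divisors, (vonMangoldt n : ℝ) * (g x - g (x / n)) ^ 2 :=
    Finset.sum_nonneg fun x _ => mul_nonneg (by positivity)
      (Finset.sum_nonneg fun n _ => mul_nonneg ArithmeticFunction.vonMangoldt_nonneg (sq_nonneg _))
  refine h.trans (mul_le_mul_of_nonneg_right ?_ hD0)
  have htot := thin_bottom_total_le hEK0 hA hc2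
  have e20 : Real.exp 20 = Real.exp 10 * Real.exp 10 := by rw [← Real.exp_add]; norm_num
  calc _ ≤ 2000 * Real.exp 10 * (Real.exp 10 * G) := htot
    _ = 2000 * Real.exp 20 * G := by rw [e20]; ring

end Summit.RiemannHypothesis.RiemannHypothesis.Theorems.IntegerScrew

end
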